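import Literature.Geometry.Lorentzian.TeukolskyWhitingOperator
import Literature.Geometry.Lorentzian.TeukolskyRealAxisModeStabilityProofs
import HarnessLib

/-!
# Whiting's kernel for the radial Teukolsky ODE on subextremal Kerr: the intertwined operator
# `𝒯̃_x` and the symmetrising weight of `𝒯_r` (Teixeira da Costa 2020, §3.2.2)

Fourth file of the proof programme for the named fact
`Literature.Geometry.Lorentzian.Kerr.Costa2019_realAxisModeStability` (R. Teixeira da Costa,
Commun. Math. Phys. 378 (2020) 705–781 = arXiv:1910.02854 [Costa2019], Thm. 4.1), continuing
`TeukolskyRadialHeunForm.lean` (the confluent Heun form `𝒯_r g = 0` of the radial ODE) and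
`TeukolskyWhitingOperator.lean` (the coefficients `P̃`, `Q̃` of the intertwined operator `𝒯̃`).
Section 3.2.2 of the source ("Differential equations for the auxiliary functions") rests on two
algebraic facts about `𝒯_r = Δ∂ᵣ² + P∂ᵣ + Q`, which this file states and proves:

* **the kernel intertwining.** For Whiting's kernel `e^{A(z−r₋)(r−r₋)}` with
  `A := −2γ/(r₊−r₋) = 2iω/(r₊−r₋)` one has `𝒯_r e^{A(z−r₋)(r−r₋)} = 𝒯̃_z e^{A(z−r₋)(r−r₋)}`,
  where `𝒯̃_z = Δ_z ∂_z² + P̃(z) ∂_z + Q̃(z)` is "another confluent Heun operator with different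
  parameters", `P̃(z) = (1−2s)(z−r₊) + (1+2ξ+2η)(z−r₋) + 2γΔ_z`,
  `Q̃(z) = 2γ(2η+1−s)(z−r₋) + 2γ(1−2s)r₋ − 2s − L`. Since `∂ᵣ` and `∂_z` act on the kernel as
  multiplication by `A(z−r₋)` and `A(r−r₋)`, this is the polynomial identity
  `Costa2019.whiting_symbol_identity`
  (`Δ_r (A(z−r₋))² + P(r) A(z−r₋) + Q(r) = Δ_z (A(r−r₋))² + P̃(z) A(r−r₋) + Q̃(z)`), packaged
  with the derivatives of the kernel in `hasDerivAt_whitingKernel_r`, `hasDerivAt_whitingKernel_x`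
  and the operator form `heunOp_whitingKernel`;
* **the symmetrising weight** `w = (r−r₋)^{2η−s}(r−r₊)^{2ξ−s}e^{2γr}` of Lemma 3.13
  (`Costa2019.heunMeasure`), its logarithmic derivative `χ` (`heunChi`, `hasDerivAt_heunMeasure`)
  and the identity `Δχ + Δ' = P` (`delta_mul_heunChi_add`) which makes `(wΔ)' = wP`, i.e. makes
  `𝒯_r` formally self-adjoint for `w dr` (this is the hypothesis `hPχ` of
  `Costa2019.lagrange_identity`, TdC Lemma 3.13); and the bookkeeping identity
  `w · heunWeight = (r−r₋)^{η}(r−r₊)^{ξ}e^{−iωr}` (`heunMeasure_mul_heunWeight`) identifying the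
  integrand `w g` of `g̃` with the second form `(r−r₋)^η (r−r₊)^ξ e^{γr} R` printed in
  (def-g-tilde-sub).

**Erratum (continued from `TeukolskyRadialHeunForm.lean`, `TeukolskyWhitingOperator.lean`).**
With the corrected constant term of `𝒯_r` (`Costa2019.heunQ`), the constant term of `𝒯̃_z`
forced by the intertwining is `2γ(1−2s)r₋ − 2s − L` (`Costa2019.heunQt`); the source (arXiv
version, (confluent-operator-tilde)) has `2γ(1−s)r₋` there, the same discrepancy `2γ s r₋`
(agreeing at `s = 0`). `whiting_symbol_identity` is the machine-checked justification.

Everything is proved (definitions with bodies + theorems; no named facts).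

## References
* R. Teixeira da Costa, CMP 378 (2020) 705–781, arXiv:1910.02854, §3.2.2, Lemmas 3.12–3.13.
  [Costa2019]
* B. F. Whiting, J. Math. Phys. 30 (1989) 1301–1305 (the transformation). [Whiting1989]
-/

noncomputable section

open Complex Set Filter Topology

namespace Literature.Geometry.Lorentzian.Kerr

namespace Costa2019

/-! ### Whiting's kernel -/

/-- The exponent scale `A := −2γ/(r₊ − r₋) = 2iω/(r₊ − r₋)` of Whiting's kernel
(`γ = −iω`). [cite: Costa2019, §3.2 (def-g-tilde-sub): "`A(r₊ − r₋) = −2γ`"] -/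
def whitingA (M a ω : ℝ) : ℂ :=
  2 * I * ω / ((rPlus M a - rMinus M a : ℝ) : ℂ)

/-- Whiting's kernel `e^{A(z − r₋)(r − r₋)}`, `z = x + iy`, `r > r₊`.
[cite: Costa2019, §3.2 (subextremal-transformation), (def-g-tilde-sub)] -/
def whitingKernel (M a ω : ℝ) (z : ℂ) (r : ℝ) : ℂ :=
  Complex.exp (whitingA M a ω * (z - rMinus M a) * ((r - rMinus M a : ℝ) : ℂ))

/-- `A (r₊ − r₋) = 2iω = −2γ`. [cite: Costa2019, §3.2 (def-g-tilde-sub)] -/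
theorem whitingA_mul_gap {M a : ℝ} (ha : |a| < M) (ω : ℝ) :
    whitingA M a ω * ((rPlus M a - rMinus M a : ℝ) : ℂ) = 2 * I * ω := by
  have h : ((rPlus M a - rMinus M a : ℝ) : ℂ) ≠ 0 := by
    exact_mod_cast (sub_pos.2 (IsSubextremal.rMinus_lt_rPlus ha)).ne'
  unfold whitingA
  field_simp

/-- `∂ᵣ e^{A(z−r₋)(r−r₋)} = A(z − r₋) · e^{A(z−r₋)(r−r₋)}`. [cite: Costa2019, §3.2.2] -/
theorem hasDerivAt_whitingKernel_r (M a ω : ℝ) (z : ℂ) (r : ℝ) :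
    HasDerivAt (fun r : ℝ => whitingKernel M a ω z r)
      (whitingKernel M a ω z r * (whitingA M a ω * (z - rMinus M a))) r := by
  have h1 : HasDerivAt (fun r : ℝ => whitingA M a ω * (z - rMinus M a) * ((r - rMinus M a : ℝ) : ℂ))
      (whitingA M a ω * (z - rMinus M a) * 1) r := by
    have h0 : HasDerivAt (fun r : ℝ => ((r - rMinus M a : ℝ) : ℂ)) 1 r := by
      simpa using ((hasDerivAt_id r).sub_const (rMinus M a)).ofReal_comp
    exact h0.const_mul _
  simpa [whitingKernel] using h1.cexp

/-- `∂ₓ e^{A(x+iy−r₋)(r−r₋)} = A(r − r₋) · e^{A(x+iy−r₋)(r−r₋)}`. [cite: Costa2019, §3.2.2] -/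
theorem hasDerivAt_whitingKernel_x (M a ω y : ℝ) (r x : ℝ) :
    HasDerivAt (fun x : ℝ => whitingKernel M a ω ((x : ℂ) + I * y) r)
      (whitingKernel M a ω ((x : ℂ) + I * y) r *
        (whitingA M a ω * ((r - rMinus M a : ℝ) : ℂ))) x := by
  have h1 : HasDerivAt
      (fun x : ℝ => whitingA M a ω * (((x : ℂ) + I * y) - rMinus M a) * ((r - rMinus M a : ℝ) : ℂ))
      (whitingA M a ω * 1 * ((r - rMinus M a : ℝ) : ℂ)) x := by
    have h0 : HasDerivAt (fun x : ℝ => ((x : ℂ) + I * y) - rMinus M a) 1 x := by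
      simpa using (((hasDerivAt_id x).ofReal_comp).add_const (I * y)).sub_const ((rMinus M a : ℝ) : ℂ)
    exact (h0.const_mul _).mul_const _
  have h2 := h1.cexp
  refine h2.congr_deriv ?_
  simp only [whitingKernel]
  ring

/-! ### The intertwined operator `𝒯̃_z` on the kernel (its coefficients `heunPt`, `heunQt` are
defined in `TeukolskyWhitingOperator.lean`) -/

/-- **The kernel intertwining as a polynomial identity** (TdC §3.2.2: "if we pick
`A = −2γ/(r₊−r₋)`, we have `𝒯̃_x e^{A(z−r₋)(r−r₋)} = 𝒯_r e^{A(z−r₋)(r−r₋)}`"): with `∂ᵣ`,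
`∂_z` acting on the kernel as `A(z − r₋)`, `A(r − r₋)`,
`Δ_r (A(z−r₋))² + P(r) A(z−r₋) + Q(r) = Δ_z (A(r−r₋))² + P̃(z) A(r−r₋) + Q̃(z)` for all real `r`
and complex `z`. [cite: Costa2019, §3.2.2] -/
theorem whiting_symbol_identity {M a : ℝ} (hM : 0 < M) (ha : |a| < M) (s ω m lam : ℝ) (z : ℂ)
    (r : ℝ) :
    (delta M a r : ℂ) * (whitingA M a ω * (z - rMinus M a)) ^ 2 +
        heunP M a s ω m r * (whitingA M a ω * (z - rMinus M a)) + heunQ a s ω m lam r =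
      (z - rPlus M a) * (z - rMinus M a) * (whitingA M a ω * ((r - rMinus M a : ℝ) : ℂ)) ^ 2 +
        heunPt M a s ω m z * (whitingA M a ω * ((r - rMinus M a : ℝ) : ℂ)) +
        heunQt M a s ω m lam z := by
  have h3 : (rPlus M a : ℂ) - (rMinus M a : ℂ) ≠ 0 := by
    rw [← Complex.ofReal_sub]
    exact_mod_cast (sub_pos.2 (IsSubextremal.rMinus_lt_rPlus ha)).ne'
  have hM2 : (M : ℂ) = ((rPlus M a : ℂ) + (rMinus M a : ℂ)) / 2 := by
    rw [← Complex.ofReal_add, rPlus_add_rMinus]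
    push_cast
    ring
  unfold heunP heunQ heunPt heunQt whitingA innerExponent
  rw [horizonExponent_eq hM ha, delta_eq_mul ha.le]
  push_cast
  rw [hM2]
  field_simp
  ring

/-- **The kernel intertwining, operator form.** For fixed `z`, the function
`r ↦ K(r) = e^{A(z−r₋)(r−r₋)}` satisfies
`Δ_r K'' + P K' + Q K = [Δ_z (A(r−r₋))² + P̃(z) A(r−r₋) + Q̃(z)] K`, the bracket being the
symbol of `𝒯̃_z` on the kernel (`∂_z K = A(r−r₋)K`, `∂_z²K = (A(r−r₋))²K`).
[cite: Costa2019, §3.2.2, Lemma 3.12 (first display of the proof)] -/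
theorem heunOp_whitingKernel {M a : ℝ} (hM : 0 < M) (ha : |a| < M) (s ω m lam : ℝ) (z : ℂ)
    (r : ℝ) :
    ∃ K₁ K₂ : ℂ, HasDerivAt (fun r : ℝ => whitingKernel M a ω z r) K₁ r ∧
      HasDerivAt (fun r : ℝ => whitingKernel M a ω z r * (whitingA M a ω * (z - rMinus M a))) K₂ r ∧
      (delta M a r : ℂ) * K₂ + heunP M a s ω m r * K₁ + heunQ a s ω m lam r * whitingKernel M a ω z r =
        ((z - rPlus M a) * (z - rMinus M a) * (whitingA M a ω * ((r - rMinus M a : ℝ) : ℂ)) ^ 2 +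
          heunPt M a s ω m z * (whitingA M a ω * ((r - rMinus M a : ℝ) : ℂ)) +
          heunQt M a s ω m lam z) * whitingKernel M a ω z r := by
  have h1 := hasDerivAt_whitingKernel_r M a ω z r
  have h2 := h1.mul_const (whitingA M a ω * (z - rMinus M a))
  refine ⟨_, _, h1, h2, ?_⟩
  rw [← whiting_symbol_identity hM ha s ω m lam z r]
  ring

/-! ### The symmetrising weight of `𝒯_r` (Lemma 3.13) -/

/-- The weight `w = (r − r₋)^{2η−s} (r − r₊)^{2ξ−s} e^{2γr}` (`γ = −iω`) against which `𝒯_r` is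
formally self-adjoint (TdC Lemma 3.13: "This lemma justifies the introduction of weights
`(r−r₋)^{2η−s}(r−r₊)^{2ξ−s}e^{2γr}`: when evaluated against such a measure, `𝒯_r` is
self-adjoint"). [cite: Costa2019, Lemma 3.13] -/
def heunMeasure (M a s ω m : ℝ) (r : ℝ) : ℂ :=
  ((r - rMinus M a : ℝ) : ℂ) ^ (2 * innerExponent M a ω m - s) *
    ((r - rPlus M a : ℝ) : ℂ) ^ (2 * horizonExponent M a ω m - s) * Complex.exp (-(2 * I * ω * r))

/-- The logarithmic derivative `χ = (2η − s)/(r − r₋) + (2ξ − s)/(r − r₊) + 2γ` of the weight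
`heunMeasure`. [cite: Costa2019, Lemma 3.13] -/
def heunChi (M a s ω m : ℝ) (r : ℝ) : ℂ :=
  (2 * innerExponent M a ω m - s) / ((r - rMinus M a : ℝ) : ℂ) +
    (2 * horizonExponent M a ω m - s) / ((r - rPlus M a : ℝ) : ℂ) - 2 * I * ω

/-- `d/dr heunMeasure = heunMeasure · χ` on `(r₊, ∞)`. [cite: Costa2019, Lemma 3.13] -/
theorem hasDerivAt_heunMeasure (M a s ω m : ℝ) {r : ℝ} (hr : rPlus M a < r) :
    HasDerivAt (heunMeasure M a s ω m) (heunMeasure M a s ω m r * heunChi M a s ω m r) r := by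
  have hq : rMinus M a < r := (rMinus_le_rPlus M a).trans_lt hr
  have hA := hasDerivAt_ofReal_sub_cpow (rMinus M a) (2 * innerExponent M a ω m - s) hq
  have hB := hasDerivAt_ofReal_sub_cpow (rPlus M a) (2 * horizonExponent M a ω m - s) hr
  have hE : HasDerivAt (fun x : ℝ => Complex.exp (-(2 * I * ω * x)))
      (Complex.exp (-(2 * I * ω * r)) * (-(2 * I * ω))) r := by
    have h1 : HasDerivAt (fun x : ℝ => -(2 * I * ω * (x : ℂ))) (-(2 * I * ω * (1 : ℝ))) r :=
      ((hasDerivAt_id r).ofReal_comp.const_mul (2 * I * ω)).neg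
    simpa using h1.cexp
  refine ((hA.mul hB).mul hE).congr_deriv ?_
  simp only [Pi.mul_apply, heunMeasure, heunChi]
  ring

/-- `Δ χ + Δ' = P` (`Δ' = 2(r − M)`): the weight `w = heunMeasure` satisfies `(wΔ)' = wP`, the
hypothesis `hPχ` of `Costa2019.lagrange_identity` for `𝒯_r = Δ∂² + P∂ + Q`.
[cite: Costa2019, Lemma 3.13] -/
theorem delta_mul_heunChi_add {M a : ℝ} (hM : 0 < M) (ha : |a| < M) (s ω m : ℝ) {r : ℝ}
    (hr : rPlus M a < r) :
    (delta M a r : ℂ) * heunChi M a s ω m r + 2 * ((r - M : ℝ) : ℂ) = heunP M a s ω m r := by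
  have hq : rMinus M a < r := (rMinus_le_rPlus M a).trans_lt hr
  have h1 : (r : ℂ) - (rPlus M a : ℂ) ≠ 0 := by
    rw [← Complex.ofReal_sub]; exact_mod_cast (sub_pos.2 hr).ne'
  have h2 : (r : ℂ) - (rMinus M a : ℂ) ≠ 0 := by
    rw [← Complex.ofReal_sub]; exact_mod_cast (sub_pos.2 hq).ne'
  have hM2 : (M : ℂ) = ((rPlus M a : ℂ) + (rMinus M a : ℂ)) / 2 := by
    rw [← Complex.ofReal_add, rPlus_add_rMinus]
    push_cast
    ring
  have _ := hM
  unfold heunChi heunP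
  rw [delta_eq_mul ha.le]
  push_cast
  rw [hM2]
  field_simp
  ring

/-- `Δ' = 2(r − M)`, complex-valued form of `Kerr.hasDerivAt_delta`. [folklore] -/
theorem hasDerivAt_delta_ofReal (M a r : ℝ) :
    HasDerivAt (fun r : ℝ => (delta M a r : ℂ)) (2 * ((r - M : ℝ) : ℂ)) r := by
  simpa using (hasDerivAt_delta M a r).ofReal_comp

/-- **Lagrange identity for `𝒯_r`** (TdC Lemma 3.13, differential form): for `C²` functions
`f`, `h` at `r > r₊`,
`d/dr [ w Δ (h f' − f h') ] = w (h 𝒯_r f − f 𝒯_r h)` with `w = heunMeasure`.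
[cite: Costa2019, Lemma 3.13] -/
theorem lagrange_identity_heun {M a : ℝ} (hM : 0 < M) (ha : |a| < M) (s ω m lam : ℝ)
    {f f₁ f₂ h h₁ h₂ : ℝ → ℂ} {r : ℝ} (hr : rPlus M a < r)
    (hf : HasDerivAt f (f₁ r) r) (hf₁ : HasDerivAt f₁ (f₂ r) r)
    (hh : HasDerivAt h (h₁ r) r) (hh₁ : HasDerivAt h₁ (h₂ r) r) :
    HasDerivAt (fun x => heunMeasure M a s ω m x * (delta M a x : ℂ) * (h x * f₁ x - f x * h₁ x))
      (heunMeasure M a s ω m r *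
        (h r * ((delta M a r : ℂ) * f₂ r + heunP M a s ω m r * f₁ r + heunQ a s ω m lam r * f r) -
          f r * ((delta M a r : ℂ) * h₂ r + heunP M a s ω m r * h₁ r +
            heunQ a s ω m lam r * h r))) r :=
  lagrange_identity (D' := fun r => 2 * ((r - M : ℝ) : ℂ)) (Q := heunQ a s ω m lam)
    (hasDerivAt_heunMeasure M a s ω m hr) (hasDerivAt_delta_ofReal M a r)
    (delta_mul_heunChi_add hM ha s ω m hr) hf hf₁ hh hh₁

/-! ### Bookkeeping: `w · heunWeight` -/

/-- `w · heunWeight = (r − r₋)^{η} (r − r₊)^{ξ} e^{−iωr}` on `(r₊, ∞)`: the integrand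
`w g = w · heunWeight · R` of `g̃` is `(r−r₋)^η (r−r₊)^ξ e^{γr} R`, the second form printed in
(def-g-tilde-sub). [cite: Costa2019, §3.2 (def-g-tilde-sub)] -/
theorem heunMeasure_mul_heunWeight (M a s ω m : ℝ) {r : ℝ} (hr : rPlus M a < r) :
    heunMeasure M a s ω m r * heunWeight M a s ω m r =
      ((r - rMinus M a : ℝ) : ℂ) ^ innerExponent M a ω m *
        ((r - rPlus M a : ℝ) : ℂ) ^ horizonExponent M a ω m * Complex.exp (-(I * ω * r)) := by
  have hq : rMinus M a < r := (rMinus_le_rPlus M a).trans_lt hr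
  have h1 : ((r - rPlus M a : ℝ) : ℂ) ≠ 0 := by exact_mod_cast (sub_pos.2 hr).ne'
  have h2 : ((r - rMinus M a : ℝ) : ℂ) ≠ 0 := by exact_mod_cast (sub_pos.2 hq).ne'
  unfold heunMeasure heunWeight
  have hA : ((r - rMinus M a : ℝ) : ℂ) ^ (2 * innerExponent M a ω m - s) *
      ((r - rMinus M a : ℝ) : ℂ) ^ ((s : ℂ) - innerExponent M a ω m) =
      ((r - rMinus M a : ℝ) : ℂ) ^ innerExponent M a ω m := by
    rw [← Complex.cpow_add _ _ h2]
    ring_nf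
  have hB : ((r - rPlus M a : ℝ) : ℂ) ^ (2 * horizonExponent M a ω m - s) *
      ((r - rPlus M a : ℝ) : ℂ) ^ ((s : ℂ) - horizonExponent M a ω m) =
      ((r - rPlus M a : ℝ) : ℂ) ^ horizonExponent M a ω m := by
    rw [← Complex.cpow_add _ _ h1]
    ring_nf
  have hE : Complex.exp (-(2 * I * ω * r)) * Complex.exp (I * ω * r) =
      Complex.exp (-(I * ω * r)) := by
    rw [← Complex.exp_add]
    ring_nf
  calc _ = (((r - rMinus M a : ℝ) : ℂ) ^ (2 * innerExponent M a ω m - s) *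
        ((r - rMinus M a : ℝ) : ℂ) ^ ((s : ℂ) - innerExponent M a ω m)) *
        (((r - rPlus M a : ℝ) : ℂ) ^ (2 * horizonExponent M a ω m - s) *
          ((r - rPlus M a : ℝ) : ℂ) ^ ((s : ℂ) - horizonExponent M a ω m)) *
        (Complex.exp (-(2 * I * ω * r)) * Complex.exp (I * ω * r)) := by ring
    _ = _ := by rw [hA, hB, hE]

/-! ### The auxiliary function near the horizon (input of Lemma 3.12) -/

/-- **`g` and `g'` are bounded near the horizon.** If `R` is outgoing at `𝓗⁺` then
`g = heunWeight · R` agrees near `r₊⁺` with a function smooth across `r₊`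
(`heunWeight_mul_smooth_at_horizon`), so `g` and any derivative `g₁` of `g` on `(r₊, ∞)` are
bounded on `(r₊, r₊ + δ)` for some `δ > 0` (TdC (g-bdry-sub): "`g = Σ bₖ (r−r₊)ᵏ` as
`r → r₊`", used in Lemma 3.12: "At the horizon, the extra factor of `(r − r₊)` makes the
boundary term vanish, due to the boundary conditions of `g`"). [cite: Costa2019, §3.2 (g-bdry-sub), Lemma 3.12] -/
theorem heunWeight_mul_bounded_near_horizon {M a s ω m : ℝ} (ha : |a| < M) {R g₁ : ℝ → ℂ}
    (hH : IsOutgoingAtHorizon M a s ω m R)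
    (hg : ∀ r, rPlus M a < r → HasDerivAt (fun x => heunWeight M a s ω m x * R x) (g₁ r) r) :
    ∃ δ B : ℝ, 0 < δ ∧ ∀ r ∈ Ioo (rPlus M a) (rPlus M a + δ),
      ‖heunWeight M a s ω m r * R r‖ ≤ B ∧ ‖g₁ r‖ ≤ B := by
  obtain ⟨ε, hε, F, hF, hgF⟩ := heunWeight_mul_smooth_at_horizon ha hH
  have hopen : IsOpen (Ioo (rPlus M a - ε) (rPlus M a + ε)) := isOpen_Ioo
  -- on `(r₊, r₊+ε)` the derivative of `g` is `deriv F`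
  have hderiv : ∀ r ∈ Ioo (rPlus M a) (rPlus M a + ε), g₁ r = deriv F r := by
    intro r hr
    have hloc : (fun x => heunWeight M a s ω m x * R x) =ᶠ[𝓝 r] F := by
      filter_upwards [isOpen_Ioo.mem_nhds hr] with x hx using hgF x hx
    have h1 : HasDerivAt F (g₁ r) r := (hg r hr.1).congr_of_eventuallyEq hloc.symm
    exact h1.deriv.symm
  have hFc : ContinuousOn F (Icc (rPlus M a - ε / 2) (rPlus M a + ε / 2)) :=
    hF.continuousOn.mono (Icc_subset_Ioo (by linarith) (by linarith))
  have hF'c : ContinuousOn (deriv F) (Icc (rPlus M a - ε / 2) (rPlus M a + ε / 2)) :=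
    (hF.continuousOn_deriv_of_isOpen hopen (by norm_num)).mono
      (Icc_subset_Ioo (by linarith) (by linarith))
  obtain ⟨B₀, hB₀⟩ := isCompact_Icc.exists_bound_of_continuousOn hFc
  obtain ⟨B₁, hB₁⟩ := isCompact_Icc.exists_bound_of_continuousOn hF'c
  refine ⟨ε / 2, max B₀ B₁, by linarith, fun r hr => ?_⟩
  have hr' : r ∈ Ioo (rPlus M a) (rPlus M a + ε) := ⟨hr.1, by linarith [hr.2]⟩
  have hrI : r ∈ Icc (rPlus M a - ε / 2) (rPlus M a + ε / 2) := ⟨by linarith [hr.1], hr.2.le⟩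
  constructor
  · rw [hgF r hr']
    exact (hB₀ r hrI).trans (le_max_left _ _)
  · rw [hderiv r hr']
    exact (hB₁ r hrI).trans (le_max_right _ _)

end Costa2019

end Literature.Geometry.Lorentzian.Kerr

end
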